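/-
VALUE = THEOREM (the reflection-class certificate over a breadth-first closure from a SHORT
generator list), NOT summit progress (cell b2b-lgcu-borel, gen 23); the crux item
stmt-MatrixMultiplication-14079 is untouched.
-/
import Mathlib
import Summits.MatrixMultiplication.MatrixMultiplication.Theorems.SubgroupIdentityDesigns.Negative.ReflectionClassCertificateFast

/-!
# Reflection classes of `GL₃(𝔽_p)`: the certificate over a breadth-first closure

VALUE = THEOREM (generic in `p`), NOT summit progress; the crux item stmt-MatrixMultiplication-14079
is untouched and remains open.

`ReflectionClassCertificateFast.KSF p σ` builds the class subgroup `K` (order `p(p² − 1)`) as the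
words of length `≤ 4` in ALL `p(p+1)/2` reflections of the class: `Θ(p⁵)` candidate words are
deduplicated against `Θ(p³)` elements inside `Finset.image`, and the closure check repeats the
work; this is the whole cost at `p = 11` (`≈ 7–10 min`) and is out of budget from `p = 13` on.
Here the same set is built by a FRONTIER breadth-first search `bfs G d` from a short list `G`
of generators, each an explicit product of class reflections (`gen`, `gens`): `|G|·|K|`
products and `|G|·|K|²` comparisons in all.  Soundness is the same chain as before:
`KSG_sub` (every element reached is a product of generators, hence lies in every subgroup
containing the class reflections, `gens_mem`), `KSG_mul_of_step` (closure under products from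
the one-step check `KSG·G ⊆ KSG`, by induction over the search, `KSG_induction`),
`ReflectionClassCertificateFast.inv_of_filter`, `ReflectionClassCertificateFast.orbit_sums_ofF`
(table, scalar representatives, sphere-only test — unchanged), and the engine
`PermutationCertificate.no_design_of_permCert`.  The certificate `certG` checks in addition that
every generator word consists of class vectors.  Member forms `no_design_sq_memᵢ_of_certG` /
`no_design_nsq_memᵢ_of_certG` (`m ≥ 3`) as in the fast file.
Timings (whole instance file, farm; three generators `r_a r_b`, `r_b r_a`, `r_c`, depth `12–14`):
`p = 7`: 16 s, `p = 11`: 108 s, `p = 13`: 256 s.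
Instances: `SquareReflectionsSeven`, `SquareReflectionsEleven`, `NonsquareReflectionsThirteen`.

HONEST SCOPE.  A reduction; by itself it excludes nothing.
-/

set_option linter.dupNamespace false

open scoped BigOperators Matrix

namespace Summit.MatrixMultiplication.MatrixMultiplication.Theorems.SubgroupIdentityDesigns.Negative
namespace ReflectionClassCertificateBFS

open Summit.MatrixMultiplication.MatrixMultiplication.Theorems.LieRankDesigns.Negative (GLm Mat)
open NonsquareReflections (refl extVec extVec_dotProduct emb_refl)
open SummandTransport (emb design_comap)
open PermutationCertificate (no_design_of_permCert)
open ReflectionClassCertificate (V det3 act act_mul act_one wt classGroup)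
open ReflectionClassCertificateFast (normF normF_eq table wtab nrm orbitTestF orbit_sums_ofF
  inv_of_filter)

variable {p : ℕ} [hp : Fact p.Prime]

/-! ## Generators and the breadth-first closure -/

/-- A generator: the product of the reflections in the vectors of the word `w`, materialised. -/
def gen (w : List (V p)) : GLm p 3 := normF (w.map refl).prod

/-- The generator set of a list of reflection words. -/
def gens (ws : List (List (V p))) : Finset (GLm p 3) := (ws.map gen).toFinset

/-- One frontier step of the search: `(S, F) ↦ (S ∪ N, N)` with `N = F·G ∖ S`
(products materialised). -/
def bfsStep (G : Finset (GLm p 3)) (SF : Finset (GLm p 3) × Finset (GLm p 3)) :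
    Finset (GLm p 3) × Finset (GLm p 3) :=
  let N := ((SF.2 ×ˢ G).image fun fg => normF (fg.1 * fg.2)) \ SF.1
  (SF.1 ∪ N, N)

/-- `d` frontier steps from `({1}, {1})`. -/
def bfs (G : Finset (GLm p 3)) (d : ℕ) : Finset (GLm p 3) × Finset (GLm p 3) :=
  (bfsStep G)^[d] ({1}, {1})

/-- The elements reached by `d` steps of the search (words of length `≤ d` in `G`). -/
def KSG (G : Finset (GLm p 3)) (d : ℕ) : Finset (GLm p 3) := (bfs G d).1

/-- Unfolding one step of the search. -/
theorem bfs_succ (G : Finset (GLm p 3)) (d : ℕ) : bfs G (d + 1) = bfsStep G (bfs G d) :=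
  Function.iterate_succ_apply' _ _ _

/-- `1` is reached. -/
theorem one_mem_KSG (G : Finset (GLm p 3)) (d : ℕ) : (1 : GLm p 3) ∈ KSG G d := by
  induction d with
  | zero => exact Finset.mem_singleton_self 1
  | succ d ih =>
    unfold KSG at ih ⊢
    rw [bfs_succ]
    exact Finset.mem_union_left _ ih

/-- The frontier is part of the reached set. -/
theorem frontier_sub (G : Finset (GLm p 3)) (d : ℕ) : (bfs G d).2 ⊆ (bfs G d).1 := by
  induction d with
  | zero => exact subset_rfl
  | succ d _ =>
    rw [bfs_succ]
    exact Finset.subset_union_right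

/-- **Induction over the search**: a property of `1` preserved under right multiplication by
generators holds on every element reached. -/
theorem KSG_induction (G : Finset (GLm p 3)) {P : GLm p 3 → Prop} (h1 : P 1)
    (hmul : ∀ a, P a → ∀ g ∈ G, P (a * g)) : ∀ d, ∀ k ∈ KSG G d, P k := by
  intro d
  induction d with
  | zero =>
    intro k hk
    rw [Finset.mem_singleton.mp hk]
    exact h1
  | succ d ih =>
    intro k hk
    have hk' : k ∈ (bfs G d).1 ∪
        ((((bfs G d).2 ×ˢ G).image fun fg => normF (fg.1 * fg.2)) \ (bfs G d).1) := by
      unfold KSG at hk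
      rwa [bfs_succ] at hk
    rcases Finset.mem_union.mp hk' with hk' | hk'
    · exact ih k hk'
    · obtain ⟨fg, hfg, rfl⟩ := Finset.mem_image.mp (Finset.mem_sdiff.mp hk').1
      obtain ⟨hf, hg⟩ := Finset.mem_product.mp hfg
      rw [normF_eq]
      exact hmul _ (ih _ (frontier_sub G d hf)) _ hg

/-- **The reached set lies in every subgroup containing the generators.** -/
theorem KSG_sub {G : Finset (GLm p 3)} {H : Subgroup (GLm p 3)} (hG : ∀ g ∈ G, g ∈ H)
    (d : ℕ) : ∀ k ∈ KSG G d, k ∈ H :=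
  KSG_induction G H.one_mem (fun _ ha g hg => H.mul_mem ha (hG g hg)) d

/-- **Closure under products from the one-step check `KSG·G ⊆ KSG`.** -/
theorem KSG_mul_of_step {G : Finset (GLm p 3)} {d : ℕ}
    (hst : ((KSG G d ×ˢ G).filter fun kg => ¬ normF (kg.1 * kg.2) ∈ KSG G d) = ∅) :
    ∀ a ∈ KSG G d, ∀ b ∈ KSG G d, a * b ∈ KSG G d := by
  have h : ∀ k ∈ KSG G d, ∀ g ∈ G, k * g ∈ KSG G d := fun k hk g hg => by
    have h' := not_not.mp (Finset.filter_eq_empty_iff.mp hst (Finset.mk_mem_product hk hg))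
    rwa [normF_eq] at h'
  intro a ha b hb
  exact KSG_induction G (P := fun b => a * b ∈ KSG G d) (by rw [mul_one]; exact ha)
    (fun b hb g hg => by rw [← mul_assoc]; exact h _ hb g hg) d b hb

/-- A generator word of class vectors lies in every subgroup containing the class reflections. -/
theorem gen_mem {σ : Bool} {H : Subgroup (GLm p 3)}
    (hR : ∀ b : V p, b ⬝ᵥ b ≠ 0 → decide (IsSquare (b ⬝ᵥ b)) = σ → refl b ∈ H)
    {w : List (V p)} (hw : ∀ b ∈ w, b ⬝ᵥ b ≠ 0 ∧ decide (IsSquare (b ⬝ᵥ b)) = σ) :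
    gen w ∈ H := by
  unfold gen
  rw [normF_eq]
  refine Subgroup.list_prod_mem H ?_
  intro x hx
  obtain ⟨b, hb, rfl⟩ := List.mem_map.mp hx
  exact hR b (hw b hb).1 (hw b hb).2

/-- All generators lie in every subgroup containing the class reflections. -/
theorem gens_mem {σ : Bool} {H : Subgroup (GLm p 3)}
    (hR : ∀ b : V p, b ⬝ᵥ b ≠ 0 → decide (IsSquare (b ⬝ᵥ b)) = σ → refl b ∈ H)
    {ws : List (List (V p))}
    (hws : ∀ w ∈ ws, ∀ b ∈ w, b ⬝ᵥ b ≠ 0 ∧ decide (IsSquare (b ⬝ᵥ b)) = σ) :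
    ∀ g ∈ gens ws, g ∈ H := by
  intro g hg
  obtain ⟨w, hw, rfl⟩ := List.mem_map.mp (List.mem_toFinset.mp hg)
  exact gen_mem hR (hws w hw)

/-! ## The certificate -/

/-- **The certificate over a breadth-first closure** (`S = KSG (gens ws) d`, `G = gens ws` in the
soundness theorem): the generator words consist of class-`σ` vectors; `S·G ⊆ S`; `S⁻¹ ⊆ S`;
`S` is orthogonal with `det² = 1`; `w(X₀) ≠ 0`; the weight table is correct; and the orbit test
passes for every scalar representative. -/
def certG (S G : Finset (GLm p 3)) (σ : Bool) (ws : List (List (V p))) (c : ZMod p)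
    (X₀ : V p) : Bool :=
  let Ω := (Finset.univ : Finset (V p)).filter fun ω => ω ⬝ᵥ ω = c
  let T := table c X₀
  decide (∀ w ∈ ws, ∀ b ∈ w, b ⬝ᵥ b ≠ 0 ∧ decide (IsSquare (b ⬝ᵥ b)) = σ) &&
  (decide (((S ×ˢ G).filter fun kg => ¬ normF (kg.1 * kg.2) ∈ S) = ∅) &&
  (decide ((S.filter fun a => ¬ a⁻¹ ∈ S) = ∅) &&
  (decide ((S.filter fun k : GLm p 3 => ¬ (((k : Mat p 3))ᵀ * (k : Mat p 3) = 1 ∧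
    det3 (k : Mat p 3) * det3 (k : Mat p 3) = 1)) = ∅) &&
  (decide (wt c X₀ X₀ ≠ 0) &&
  (decide (∀ v : V p, wtab T v = wt c X₀ v) &&
  decide (∀ x : V p, nrm x = true → orbitTestF S Ω T x = true))))))

/-- Unpacking the certificate. -/
theorem certG_spec {S G : Finset (GLm p 3)} {σ : Bool} {ws : List (List (V p))} {c : ZMod p}
    {X₀ : V p} (h : certG S G σ ws c X₀ = true) :
    (∀ w ∈ ws, ∀ b ∈ w, b ⬝ᵥ b ≠ 0 ∧ decide (IsSquare (b ⬝ᵥ b)) = σ) ∧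
    ((S ×ˢ G).filter fun kg => ¬ normF (kg.1 * kg.2) ∈ S) = ∅ ∧
    (S.filter fun a => ¬ a⁻¹ ∈ S) = ∅ ∧
    (S.filter fun k : GLm p 3 => ¬ (((k : Mat p 3))ᵀ * (k : Mat p 3) = 1 ∧
      det3 (k : Mat p 3) * det3 (k : Mat p 3) = 1)) = ∅ ∧
    wt c X₀ X₀ ≠ 0 ∧ (∀ v : V p, wtab (table c X₀) v = wt c X₀ v) ∧
    (∀ x : V p, nrm x = true → orbitTestF S
      ((Finset.univ : Finset (V p)).filter fun ω => ω ⬝ᵥ ω = c) (table c X₀) x = true) := by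
  unfold certG at h
  simp only [Bool.and_eq_true, decide_eq_true_eq] at h
  exact ⟨h.1, h.2.1, h.2.2.1, h.2.2.2.1, h.2.2.2.2.1, h.2.2.2.2.2.1, h.2.2.2.2.2.2⟩

/-! ## The exclusions -/

section Exclusions

variable {σ : Bool} {ws : List (List (V p))} {d : ℕ} {c : ZMod p} {X₀ : V p} {m : ℕ}

/-- **Soundness**: once `certG (KSG (gens ws) d) (gens ws) σ ws c X₀ = true`, no triple whose
product set covers the class subgroup minus `1` carries a level-one identity design. -/
theorem no_design_of_certG {H₁ H₂ H₃ : Subgroup (GLm p 3)}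
    (hc : certG (KSG (gens ws) d) (gens ws) σ ws c X₀ = true)
    (hmem : ∀ k ∈ classGroup p σ, k ≠ 1 → ∃ a ∈ H₁, ∃ b ∈ H₂, ∃ g ∈ H₃, a * b * g = k) :
    ¬ ∃ f : Mat p 3 → ℂ, (∀ M, 1 < M.rank → f M = 0) ∧
      (∑ M, f M * ZMod.stdAddChar (Matrix.trace (M * ((1 : GLm p 3) : Mat p 3)))) = 1 ∧
      ∀ a ∈ H₁, ∀ b ∈ H₂, ∀ g ∈ H₃, a * b * g ≠ 1 →
        (∑ M, f M * ZMod.stdAddChar (Matrix.trace (M * ((a * b * g : GLm p 3) : Mat p 3)))) = 0 :=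
  by
  have hc' := certG_spec hc
  exact no_design_of_permCert (KSG (gens ws) d) (one_mem_KSG _ d) (KSG_mul_of_step hc'.2.1)
    (inv_of_filter hc'.2.2.1) act act_mul act_one (wt c X₀) ⟨X₀, hc'.2.2.2.2.1⟩
    (orbit_sums_ofF hc'.2.2.2.1 hc'.2.2.2.2.2.1 hc'.2.2.2.2.2.2)
    fun k hk hk1 => hmem k (KSG_sub (gens_mem (H := classGroup p σ)
      (fun b hb0 hb => Subgroup.subset_closure ⟨b, hb0, hb, rfl⟩) hc'.1) d k hk) hk1

/-- **SQUARE CLASS: once `certG (KSG (gens ws) d) (gens ws) true ws c X₀ = true` is evaluated,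
NO MEMBER OF A TRIPLE IN `GL_m(𝔽_p)`, `m ≥ 3`, CONTAINS ALL SQUARE REFLECTIONS of `𝔽_p^m`**
(three coordinates suffice): member `1`. -/
theorem no_design_sq_mem₁_of_certG
    (hc : certG (KSG (gens ws) d) (gens ws) true ws c X₀ = true) (hm : 3 ≤ m)
    {H₁ H₂ H₃ : Subgroup (GLm p m)}
    (h₁ : ∀ b : Fin m → ZMod p, b ⬝ᵥ b ≠ 0 → IsSquare (b ⬝ᵥ b) → refl b ∈ H₁) :
    ¬ ∃ f : Mat p m → ℂ, (∀ M, 1 < M.rank → f M = 0) ∧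
      (∑ M, f M * ZMod.stdAddChar (Matrix.trace (M * ((1 : GLm p m) : Mat p m)))) = 1 ∧
      ∀ a ∈ H₁, ∀ b ∈ H₂, ∀ g ∈ H₃, a * b * g ≠ 1 →
        (∑ M, f M * ZMod.stdAddChar (Matrix.trace (M * ((a * b * g : GLm p m) : Mat p m)))) = 0 :=
  by
  obtain ⟨l, rfl⟩ := Nat.exists_eq_add_of_le hm
  intro hdes
  refine no_design_of_certG (H₁ := H₁.comap (emb finSumFinEquiv))
    (H₂ := H₂.comap (emb finSumFinEquiv)) (H₃ := H₃.comap (emb finSumFinEquiv)) hc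
    (triple_of_le₁ ((Subgroup.closure_le _).mpr ?_)) (design_comap finSumFinEquiv 1 hdes)
  rintro _ ⟨b, hb0, hb, rfl⟩
  refine Subgroup.mem_comap.mpr ?_
  rw [emb_refl]
  exact h₁ _ (by rwa [extVec_dotProduct]) (by rw [extVec_dotProduct]; exact of_decide_eq_true hb)

/-- Square class, member `2`. -/
theorem no_design_sq_mem₂_of_certG
    (hc : certG (KSG (gens ws) d) (gens ws) true ws c X₀ = true) (hm : 3 ≤ m)
    {H₁ H₂ H₃ : Subgroup (GLm p m)}
    (h₂ : ∀ b : Fin m → ZMod p, b ⬝ᵥ b ≠ 0 → IsSquare (b ⬝ᵥ b) → refl b ∈ H₂) :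
    ¬ ∃ f : Mat p m → ℂ, (∀ M, 1 < M.rank → f M = 0) ∧
      (∑ M, f M * ZMod.stdAddChar (Matrix.trace (M * ((1 : GLm p m) : Mat p m)))) = 1 ∧
      ∀ a ∈ H₁, ∀ b ∈ H₂, ∀ g ∈ H₃, a * b * g ≠ 1 →
        (∑ M, f M * ZMod.stdAddChar (Matrix.trace (M * ((a * b * g : GLm p m) : Mat p m)))) = 0 :=
  by
  obtain ⟨l, rfl⟩ := Nat.exists_eq_add_of_le hm
  intro hdes
  refine no_design_of_certG (H₁ := H₁.comap (emb finSumFinEquiv))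
    (H₂ := H₂.comap (emb finSumFinEquiv)) (H₃ := H₃.comap (emb finSumFinEquiv)) hc
    (triple_of_le₂ ((Subgroup.closure_le _).mpr ?_)) (design_comap finSumFinEquiv 1 hdes)
  rintro _ ⟨b, hb0, hb, rfl⟩
  refine Subgroup.mem_comap.mpr ?_
  rw [emb_refl]
  exact h₂ _ (by rwa [extVec_dotProduct]) (by rw [extVec_dotProduct]; exact of_decide_eq_true hb)

/-- Square class, member `3`. -/
theorem no_design_sq_mem₃_of_certG
    (hc : certG (KSG (gens ws) d) (gens ws) true ws c X₀ = true) (hm : 3 ≤ m)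
    {H₁ H₂ H₃ : Subgroup (GLm p m)}
    (h₃ : ∀ b : Fin m → ZMod p, b ⬝ᵥ b ≠ 0 → IsSquare (b ⬝ᵥ b) → refl b ∈ H₃) :
    ¬ ∃ f : Mat p m → ℂ, (∀ M, 1 < M.rank → f M = 0) ∧
      (∑ M, f M * ZMod.stdAddChar (Matrix.trace (M * ((1 : GLm p m) : Mat p m)))) = 1 ∧
      ∀ a ∈ H₁, ∀ b ∈ H₂, ∀ g ∈ H₃, a * b * g ≠ 1 →
        (∑ M, f M * ZMod.stdAddChar (Matrix.trace (M * ((a * b * g : GLm p m) : Mat p m)))) = 0 :=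
  by
  obtain ⟨l, rfl⟩ := Nat.exists_eq_add_of_le hm
  intro hdes
  refine no_design_of_certG (H₁ := H₁.comap (emb finSumFinEquiv))
    (H₂ := H₂.comap (emb finSumFinEquiv)) (H₃ := H₃.comap (emb finSumFinEquiv)) hc
    (triple_of_le₃ ((Subgroup.closure_le _).mpr ?_)) (design_comap finSumFinEquiv 1 hdes)
  rintro _ ⟨b, hb0, hb, rfl⟩
  refine Subgroup.mem_comap.mpr ?_
  rw [emb_refl]
  exact h₃ _ (by rwa [extVec_dotProduct]) (by rw [extVec_dotProduct]; exact of_decide_eq_true hb)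

/-- **NON-SQUARE CLASS: once `certG (KSG (gens ws) d) (gens ws) false ws c X₀ = true` is
evaluated, no member of a
triple in `GL_m(𝔽_p)`, `m ≥ 3`, contains all non-square reflections**: member `1`. -/
theorem no_design_nsq_mem₁_of_certG
    (hc : certG (KSG (gens ws) d) (gens ws) false ws c X₀ = true) (hm : 3 ≤ m)
    {H₁ H₂ H₃ : Subgroup (GLm p m)}
    (h₁ : ∀ b : Fin m → ZMod p, ¬ IsSquare (b ⬝ᵥ b) → refl b ∈ H₁) :
    ¬ ∃ f : Mat p m → ℂ, (∀ M, 1 < M.rank → f M = 0) ∧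
      (∑ M, f M * ZMod.stdAddChar (Matrix.trace (M * ((1 : GLm p m) : Mat p m)))) = 1 ∧
      ∀ a ∈ H₁, ∀ b ∈ H₂, ∀ g ∈ H₃, a * b * g ≠ 1 →
        (∑ M, f M * ZMod.stdAddChar (Matrix.trace (M * ((a * b * g : GLm p m) : Mat p m)))) = 0 :=
  by
  obtain ⟨l, rfl⟩ := Nat.exists_eq_add_of_le hm
  intro hdes
  refine no_design_of_certG (H₁ := H₁.comap (emb finSumFinEquiv))
    (H₂ := H₂.comap (emb finSumFinEquiv)) (H₃ := H₃.comap (emb finSumFinEquiv)) hc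
    (triple_of_le₁ ((Subgroup.closure_le _).mpr ?_)) (design_comap finSumFinEquiv 1 hdes)
  rintro _ ⟨b, -, hb, rfl⟩
  refine Subgroup.mem_comap.mpr ?_
  rw [emb_refl]
  exact h₁ _ (by rw [extVec_dotProduct]; exact of_decide_eq_false hb)

/-- Non-square class, member `2`. -/
theorem no_design_nsq_mem₂_of_certG
    (hc : certG (KSG (gens ws) d) (gens ws) false ws c X₀ = true) (hm : 3 ≤ m)
    {H₁ H₂ H₃ : Subgroup (GLm p m)}
    (h₂ : ∀ b : Fin m → ZMod p, ¬ IsSquare (b ⬝ᵥ b) → refl b ∈ H₂) :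
    ¬ ∃ f : Mat p m → ℂ, (∀ M, 1 < M.rank → f M = 0) ∧
      (∑ M, f M * ZMod.stdAddChar (Matrix.trace (M * ((1 : GLm p m) : Mat p m)))) = 1 ∧
      ∀ a ∈ H₁, ∀ b ∈ H₂, ∀ g ∈ H₃, a * b * g ≠ 1 →
        (∑ M, f M * ZMod.stdAddChar (Matrix.trace (M * ((a * b * g : GLm p m) : Mat p m)))) = 0 :=
  by
  obtain ⟨l, rfl⟩ := Nat.exists_eq_add_of_le hm
  intro hdes
  refine no_design_of_certG (H₁ := H₁.comap (emb finSumFinEquiv))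
    (H₂ := H₂.comap (emb finSumFinEquiv)) (H₃ := H₃.comap (emb finSumFinEquiv)) hc
    (triple_of_le₂ ((Subgroup.closure_le _).mpr ?_)) (design_comap finSumFinEquiv 1 hdes)
  rintro _ ⟨b, -, hb, rfl⟩
  refine Subgroup.mem_comap.mpr ?_
  rw [emb_refl]
  exact h₂ _ (by rw [extVec_dotProduct]; exact of_decide_eq_false hb)

/-- Non-square class, member `3`. -/
theorem no_design_nsq_mem₃_of_certG
    (hc : certG (KSG (gens ws) d) (gens ws) false ws c X₀ = true) (hm : 3 ≤ m)
    {H₁ H₂ H₃ : Subgroup (GLm p m)}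
    (h₃ : ∀ b : Fin m → ZMod p, ¬ IsSquare (b ⬝ᵥ b) → refl b ∈ H₃) :
    ¬ ∃ f : Mat p m → ℂ, (∀ M, 1 < M.rank → f M = 0) ∧
      (∑ M, f M * ZMod.stdAddChar (Matrix.trace (M * ((1 : GLm p m) : Mat p m)))) = 1 ∧
      ∀ a ∈ H₁, ∀ b ∈ H₂, ∀ g ∈ H₃, a * b * g ≠ 1 →
        (∑ M, f M * ZMod.stdAddChar (Matrix.trace (M * ((a * b * g : GLm p m) : Mat p m)))) = 0 :=
  by
  obtain ⟨l, rfl⟩ := Nat.exists_eq_add_of_le hm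
  intro hdes
  refine no_design_of_certG (H₁ := H₁.comap (emb finSumFinEquiv))
    (H₂ := H₂.comap (emb finSumFinEquiv)) (H₃ := H₃.comap (emb finSumFinEquiv)) hc
    (triple_of_le₃ ((Subgroup.closure_le _).mpr ?_)) (design_comap finSumFinEquiv 1 hdes)
  rintro _ ⟨b, -, hb, rfl⟩
  refine Subgroup.mem_comap.mpr ?_
  rw [emb_refl]
  exact h₃ _ (by rw [extVec_dotProduct]; exact of_decide_eq_false hb)

end Exclusions

end ReflectionClassCertificateBFS
end Summit.MatrixMultiplication.MatrixMultiplication.Theorems.SubgroupIdentityDesigns.Negative
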